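import Literature.NumberTheory.EllipticCurves.PAdicLFunctionNeZeroProofs
import Literature.NumberTheory.EllipticCurves.ModularSymbolsPeriodHomology
import Literature.NumberTheory.LFunctions.PrimeNumberTheoremProgressions
import Mathlib.NumberTheory.ModularForms.Bounds
import Mathlib.Analysis.PSeries
import HarnessLib

/-!
# Manin–Drinfeld for rational newforms; `[r]^± ∈ ℚ · Ω^±` from Eichler–Shimura alone
# (provefact `Literature.NumberTheory.EllipticCurves.ModularForms.IsNewform0.exists_rat_smul_plusPeriod`)

D-0014 keeps `Literature/` sorry-free by stating cited results as named facts `def X : Prop`.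
The named fact `IsNewform0.exists_rat_smul_plusPeriod` of `ModularSymbols` (Manin 1972, Cor. 3.6
with Thm. 1.9: for a normalised newform `f ∈ S₂(Γ₀(N))` with rational coefficients, `Ω⁺_f ≠ 0`
and `re [r]_f^+ ∈ ℚ · Ω⁺_f`) was reduced in `ModularSymbolsHeckeProofs`
(`IsNewform0.exists_rat_smul_plusPeriod_of`) to three named facts: Eichler–Shimura
(`isZLattice_periodLattice`), conjugation-stability of `Λ_f` (`conj_mem_periodLattice`, since
proved: `conj_mem_periodLattice_holds` in `PAdicLFunctionDistributionProofs`) and the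
Manin–Drinfeld theorem (`exists_nsmul_modularSymbol_mem_periodLattice f`). This file **proves the
Manin–Drinfeld theorem for rational newforms** and so reduces
`IsNewform0.exists_rat_smul_plusPeriod` (and its minus analogue) to Eichler–Shimura alone, in
either of its two equivalent forms `isZLattice_periodLattice` / `periodLattice_eq_closure_pair`
(`ModularSymbolsLattice`, where the spanning half `periodLattice_span_eq_top` is proved), and
further — through `periodLattice_eq_closure_pair_of` of `ModularSymbolsPeriodHomology` (Hecke
operators on the period homology and multiplicity one, both proved there and in
`NewformsHeckeProofs`) — to the single named fact `periodHomology_eq_span_basis N`: the period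
homology `{h ↦ ⟨γ, h⟩ : γ ∈ Γ₀(N)} ⊆ S₂(Γ₀(N))^∨` is the `ℤ`-span of an `ℝ`-basis
(Eichler–Shimura for `X₀(N)`: Diamond–Shurman §6.1; Cremona 1997, (2.10.1)).

The proof of Manin–Drinfeld follows Manin 1972, Thm. 3.3, (20) and Thm. 3.5, (22) ("closing the
path" with a Hecke operator), arranged prime by prime as in Drinfeld's proof and Cremona 1997,
§2.8, (2.8.8): for a prime `p ≡ 1 (mod N)` the Hecke relation
`a_p {∞, r} = ∑_{j mod p} {∞, (r + j)/p} + {∞, p r}` (Mazur–Tate–Teitelbaum (4.2),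
`cuspCoeff_mul_modularSymbol`) has all `p + 1` cusps on the right `Γ(N)`-equivalent to `r`
(`Literature.NumberTheory.EllipticCurves.modularSymbol_mul_sub_mem_periodLattice`, `Literature.NumberTheory.EllipticCurves.modularSymbol_div_sub_mem_periodLattice` of
`PAdicLFunctionNeZeroProofs`, from Diamond–Shurman Lemma 3.8.2), so
`(a_p - p - 1) {∞, r}_f ∈ Λ_f`; with `a_p ∈ ℚ` and `a_p ≠ p + 1` this gives `n {∞, r}_f ∈ Λ_f`,
`n > 0`. Manin (Thm. 3.3) takes the non-vanishing of his factor `∑_{d ∣ m} d - c_m` "for large `m`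
from the growth estimates of the coefficients"; prime by prime this is: **there are infinitely
many primes `p ≡ 1 (mod N)` with `a_p ≠ p + 1`** (`IsNewform0.setOf_prime_cuspCoeff_ne_infinite`).
We prove it from Hecke's bound `|a_n| ≤ C n` (Mathlib `CuspFormClass.qExpansion_isBigO`) and the
multiplicativity `a_{∏ p} = ∏ a_p` over distinct good primes (Atkin–Lehner 1970, Thm. 3, from
`qExpansion_coeff_heckeT_holds` and `IsNewform0.heckeEigenvalue_eq_coeff_holds`): if `a_p = p + 1`
for all large `p ≡ 1 (mod N)` then `a_n / n = ∏_{p ∈ S} (1 + 1/p) ≥ 1 + ∑_{p ∈ S} 1/p` for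
`n = ∏_{p ∈ S} p`, unbounded because **`∑_{p ≡ 1 (N)} 1/p` diverges** — deduced here
(`exists_finset_prime_modEq_one_le_sum_one_div`, dyadic blocks) from the prime number theorem for
the progression `1 mod N` in `θ`-form, `Literature.NumberTheory.LFunctions.sum_log_prime_residue_isLittleO`
(`PrimeNumberTheoremProgressions`, Montgomery–Vaughan Cor. 11.17). (For the newform of an elliptic
curve `PAdicLFunctionNeZeroProofs` uses instead `a_p - p - 1 = -#Ẽ(𝔽_p) ≠ 0`; a general rational
newform has no curve attached before Eichler–Shimura, whence the analytic argument here.)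

## Main results (`f ∈ S₂(Γ₀(N))`; `hf : IsNewform0 f`, `hQ : coeffField f = ⊥` where stated)

* `exists_finset_le_sum_one_div_of_isLittleO`, `exists_finset_prime_modEq_one_le_sum_one_div` :
  `θ_P(X) = cX + o(X)`, `c > 0` ⇒ `∑_{P n} 1/n` unbounded; `∑_{p ≡ 1 (N)} 1/p` unbounded;
* `IsNewform0.cuspCoeff_prime_mul_of_not_dvd`, `IsNewform0.cuspCoeff_prod_primes` :
  `a_{pm} = a_p a_m` (`p ∤ N m`), `a_{∏ p} = ∏ a_p` (Atkin–Lehner 1970, Thm. 3);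
* `exists_norm_cuspCoeff_le_mul` : Hecke's bound `|a_n(f)| ≤ C n` in weight `2`;
* `IsNewform0.setOf_prime_cuspCoeff_ne_infinite` : infinitely many `p ≡ 1 (N)` with
  `a_p ≠ p + 1`;
* `sub_mul_modularSymbol_mem_periodLattice_of_hecke` : closing the path, `(a - p - 1){∞, r} ∈ Λ_f`;
* `exists_nsmul_modularSymbol_mem_periodLattice_of_isNewform0` : **Manin–Drinfeld** for rational
  newforms (the named fact `exists_nsmul_modularSymbol_mem_periodLattice f`, proved);
* `IsNewform0.exists_rat_smul_minusPeriod_of` : the minus analogue of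
  `IsNewform0.exists_rat_smul_plusPeriod_of`;
* `IsNewform0.exists_rat_smul_plusPeriod_of_isZLattice`, `…_of_closure_pair`,
  `IsNewform0.exists_rat_smul_minusPeriod_of_isZLattice`, `…_of_closure_pair`,
  `IsNewform0.exists_normalizedPlusSymbol_eq_ratCast_of_closure_pair` : the named facts
  `IsNewform0.exists_rat_smul_plusPeriod`, `IsNewform0.exists_rat_smul_minusPeriod`,
  `IsNewform0.exists_normalizedPlusSymbol_eq_ratCast` **from Eichler–Shimura alone**;
* `IsNewform0.exists_rat_smul_plusPeriod_of_periodHomology`,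
  `IsNewform0.exists_rat_smul_minusPeriod_of_periodHomology`,
  `IsNewform0.exists_normalizedPlusSymbol_eq_ratCast_of_periodHomology` : the same three named
  facts from `periodHomology_eq_span_basis N` alone.

When `periodHomology_eq_span_basis N` is discharged,
`IsNewform0.exists_rat_smul_plusPeriod_of_periodHomology periodHomology_eq_span_basis_holds` is
`IsNewform0.exists_rat_smul_plusPeriod_holds` (likewise with `isZLattice_periodLattice_holds` and
`IsNewform0.exists_rat_smul_plusPeriod_of_isZLattice`).

## References

* Ju. I. Manin, *Parabolic points and zeta functions of modular curves*, Izv. Akad. Nauk SSSR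
  Ser. Mat. 36 (1972), 19–66 (Engl. transl. Math. USSR-Izv. 6 (1972), 19–64): Thm. 3.3, (20);
  §3.4, (21); Thm. 3.5, (22) and the remark after it (rational eigenvalues); Cor. 3.6.
* V. G. Drinfeld, *Two theorems on modular curves*, Funct. Anal. Appl. 7 (1973), 155–156.
* J. E. Cremona, *Algorithms for modular elliptic curves*, 2nd ed. (1997), §2.8, (2.8.8)–(2.8.9).
* A. O. L. Atkin, J. Lehner, *Hecke operators on `Γ₀(m)`*, Math. Ann. 185 (1970), Thm. 3.
* F. Diamond, J. Shurman, *A first course in modular forms*, GTM 228 (2005), Lemma 3.8.2,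
  Prop. 5.2.2, Prop. 5.9.1 (Hecke's bound).
* H. L. Montgomery, R. C. Vaughan, *Multiplicative number theory I*, CUP (2007), Cor. 4.12,
  Cor. 11.17.
* B. Mazur, J. Tate, J. Teitelbaum, *On `p`-adic analogues of the conjectures of Birch and
  Swinnerton-Dyer*, Invent. Math. 84 (1986), §I.4 (4.2), §I.8.
-/

noncomputable section

open scoped MatrixGroups ModularForm

open CongruenceSubgroup Complex Finset Filter Asymptotics

namespace Literature.NumberTheory.EllipticCurves.ModularForms

/-! ### An elementary inequality -/

/-- `1 + ∑ xᵢ ≤ ∏ (1 + xᵢ)` for nonnegative reals `xᵢ`. [folklore] -/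
theorem one_add_sum_le_prod_one_add {ι : Type*} (s : Finset ι) {x : ι → ℝ}
    (hx : ∀ i ∈ s, 0 ≤ x i) : 1 + ∑ i ∈ s, x i ≤ ∏ i ∈ s, (1 + x i) := by
  classical
  induction s using Finset.induction_on with
  | empty => simp
  | insert a s ha ih =>
    rw [Finset.sum_insert ha, Finset.prod_insert ha]
    have hx' : ∀ i ∈ s, 0 ≤ x i := fun i hi ↦ hx i (Finset.mem_insert_of_mem hi)
    have ha0 := hx a (Finset.mem_insert_self a s)
    have hs0 : 0 ≤ ∑ i ∈ s, x i := Finset.sum_nonneg hx'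
    have h := ih hx'
    nlinarith

/-! ### Divergence of `∑ 1/p` over the primes `p ≡ 1 (mod N)` (from the prime number theorem for
arithmetic progressions) -/

section Reciprocals

/-- Splitting `θ_P(X) = ∑_{n ≤ X, P n} log n` at `Y`: `θ_P(2Y) - θ_P(Y) = ∑_{Y < n ≤ 2Y, P n} log n`.
[folklore] -/
theorem sum_Icc_filter_log_two_mul_sub (P : ℕ → Prop) [DecidablePred P] (Y : ℕ) :
    ∑ n ∈ (Icc 1 (2 * Y)).filter P, Real.log n - ∑ n ∈ (Icc 1 Y).filter P, Real.log n =
      ∑ n ∈ (Ioc Y (2 * Y)).filter P, Real.log n := by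
  have h1 : Icc 1 (2 * Y) = Ioc 0 (2 * Y) := Icc_add_one_left_eq_Ioc 0 (2 * Y)
  have h2 : Icc 1 Y = Ioc 0 Y := Icc_add_one_left_eq_Ioc 0 Y
  rw [h1, h2, ← Ioc_union_Ioc_eq_Ioc (Nat.zero_le Y) (Nat.le_mul_of_pos_left Y two_pos),
    filter_union, sum_union (disjoint_filter_filter (Ioc_disjoint_Ioc_of_le le_rfl)),
    add_sub_cancel_left]

/-- On a dyadic block `T ⊆ (Y, 2Y]`: `∑_{n ∈ T} log n ≤ log(2Y) · 2Y · ∑_{n ∈ T} 1/n`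
(termwise, `log n ≤ log(2Y) ≤ log(2Y) · (2Y/n)`). [folklore] -/
theorem sum_log_le_mul_sum_one_div {Y : ℕ} (hY : 1 ≤ Y) (T : Finset ℕ)
    (hT : T ⊆ Ioc Y (2 * Y)) :
    ∑ n ∈ T, Real.log n ≤ Real.log (2 * Y) * (2 * Y) * ∑ n ∈ T, (1 : ℝ) / n := by
  rw [Finset.mul_sum]
  refine Finset.sum_le_sum fun n hn ↦ ?_
  have hn' := Finset.mem_Ioc.mp (hT hn)
  have hn0 : (0 : ℝ) < n := by exact_mod_cast lt_of_le_of_lt (Nat.zero_le _) hn'.1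
  have hn2 : (n : ℝ) ≤ 2 * Y := by exact_mod_cast hn'.2
  have hlog : Real.log n ≤ Real.log (2 * Y) := Real.log_le_log hn0 hn2
  have hlog0 : 0 ≤ Real.log (2 * Y) := Real.log_nonneg (by exact_mod_cast (by omega : 1 ≤ 2 * Y))
  calc Real.log n ≤ Real.log (2 * Y) * 1 := by rw [mul_one]; exact hlog
    _ ≤ Real.log (2 * Y) * ((2 * Y) * (1 / n)) := by
        refine mul_le_mul_of_nonneg_left ?_ hlog0
        rw [mul_one_div, le_div_iff₀ hn0, one_mul]
        exact hn2
    _ = Real.log (2 * Y) * (2 * Y) * (1 / n) := by ring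

/-- **Unbounded reciprocal sums from logarithmic density** (the step from the prime number theorem
for arithmetic progressions, Montgomery–Vaughan 2007, Cor. 11.17, to the divergence of
`∑_{p ≡ a (q)} 1/p`, ibid. Cor. 4.12 / (4.27)): if `θ_P(X) = ∑_{n ≤ X, P n} log n = cX + o(X)`
with `c > 0`, then for all `B` and `P₀` some finite set of `n > P₀` with `P n` has `∑ 1/n ≥ B`.
Proof: for `Y` large, `θ_P(2Y) - θ_P(Y) ≥ (5c/8) Y`, so `∑_{Y < n ≤ 2Y, P n} 1/n ≥ (5c/16)/log(2Y)`
(`sum_log_le_mul_sum_one_div`); over the dyadic blocks `(2^k X₁, 2^{k+1} X₁]`, `k < K`, this is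
`≫ ∑_{k < K} 1/(k+1) → ∞` (Mathlib `Real.tendsto_sum_range_one_div_nat_succ_atTop`).
[cite: MontgomeryVaughan2007, Cor. 4.12 with Cor. 11.17] -/
theorem exists_finset_le_sum_one_div_of_isLittleO {P : ℕ → Prop} [DecidablePred P] {c : ℝ}
    (hc : 0 < c)
    (hθ : (fun X : ℕ ↦ ∑ n ∈ (Icc 1 X).filter P, Real.log n - c * X) =o[atTop]
      fun X : ℕ ↦ (X : ℝ))
    (B : ℝ) (P₀ : ℕ) :
    ∃ S : Finset ℕ, (∀ n ∈ S, P n ∧ P₀ < n) ∧ B ≤ ∑ n ∈ S, (1 : ℝ) / n := by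
  set θ : ℕ → ℝ := fun X ↦ ∑ n ∈ (Icc 1 X).filter P, Real.log n with hθdef
  have h1 : ∀ᶠ X : ℕ in atTop, |θ X - c * X| ≤ c / 8 * X := by
    filter_upwards [hθ.def (by positivity : (0 : ℝ) < c / 8)] with X hX
    simpa only [Real.norm_eq_abs, Nat.abs_cast] using hX
  obtain ⟨X₀, hX₀⟩ := eventually_atTop.mp h1
  set X₁ : ℕ := max (max X₀ (P₀ + 1)) 2 with hX₁def
  have hX₁0 : X₀ ≤ X₁ := le_max_of_le_left (le_max_left _ _)
  have hX₁P : P₀ + 1 ≤ X₁ := le_max_of_le_left (le_max_right _ _)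
  have hX₁2 : 2 ≤ X₁ := le_max_right _ _
  have hlogX : 0 < Real.log (2 * X₁) := Real.log_pos (by exact_mod_cast (by omega : 1 < 2 * X₁))
  -- the dyadic block estimate
  have hblock : ∀ k : ℕ, 5 * c / 16 / (((k : ℝ) + 1) * Real.log (2 * X₁)) ≤
      ∑ n ∈ (Ioc (2 ^ k * X₁) (2 ^ (k + 1) * X₁)).filter P, (1 : ℝ) / n := by
    intro k
    set Y : ℕ := 2 ^ k * X₁ with hY
    have hY1 : X₁ ≤ Y := Nat.le_mul_of_pos_left X₁ (Nat.two_pow_pos k)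
    have h2Y : 2 ^ (k + 1) * X₁ = 2 * Y := by rw [hY, pow_succ]; ring
    rw [h2Y]
    have hdiff := sum_Icc_filter_log_two_mul_sub P Y
    have hA := hX₀ (2 * Y) (by omega)
    have hB := hX₀ Y (by omega)
    have hlow : 5 * c / 8 * Y ≤ ∑ n ∈ (Ioc Y (2 * Y)).filter P, Real.log n := by
      rw [← hdiff]
      rw [abs_le] at hA hB
      push_cast at hA
      linarith [hA.1, hB.2]
    have hup := sum_log_le_mul_sum_one_div (by omega : 1 ≤ Y) ((Ioc Y (2 * Y)).filter P)
      (filter_subset _ _)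
    have hYpos : (0 : ℝ) < Y := by exact_mod_cast (by omega : 0 < Y)
    have hlog2Y : 0 < Real.log (2 * Y) := Real.log_pos (by exact_mod_cast (by omega : 1 < 2 * Y))
    have hSig : 5 * c / 16 / Real.log (2 * Y) ≤ ∑ n ∈ (Ioc Y (2 * Y)).filter P, (1 : ℝ) / n := by
      rw [div_le_iff₀ hlog2Y]
      have h := hlow.trans hup
      by_contra hlt
      push Not at hlt
      have : Real.log (2 * Y) * (2 * Y) * ∑ n ∈ (Ioc Y (2 * Y)).filter P, (1 : ℝ) / n <
          5 * c / 8 * Y := by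
        calc Real.log (2 * Y) * (2 * Y) * ∑ n ∈ (Ioc Y (2 * Y)).filter P, (1 : ℝ) / n
            = ((∑ n ∈ (Ioc Y (2 * Y)).filter P, (1 : ℝ) / n) * Real.log (2 * Y)) * (2 * Y) := by
              ring
          _ < (5 * c / 16) * (2 * Y) := by gcongr
          _ = 5 * c / 8 * Y := by ring
      linarith
    have hlogle : Real.log (2 * Y) ≤ ((k : ℝ) + 1) * Real.log (2 * X₁) := by
      have hX₁1 : (1 : ℝ) ≤ X₁ := by exact_mod_cast (by omega : 1 ≤ X₁)
      have h : (2 * Y : ℝ) ≤ (2 * X₁ : ℝ) ^ (k + 1) := by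
        rw [mul_pow, hY]
        push_cast
        rw [pow_succ]
        have h1 : (X₁ : ℝ) ≤ (X₁ : ℝ) ^ (k + 1) := le_self_pow₀ hX₁1 (by omega)
        have h2 : (0 : ℝ) < 2 ^ k := pow_pos two_pos k
        nlinarith
      calc Real.log (2 * Y) ≤ Real.log ((2 * X₁ : ℝ) ^ (k + 1)) :=
            Real.log_le_log (by positivity) h
        _ = ((k : ℝ) + 1) * Real.log (2 * X₁) := by rw [Real.log_pow]; push_cast; ring
    calc 5 * c / 16 / (((k : ℝ) + 1) * Real.log (2 * X₁)) ≤ 5 * c / 16 / Real.log (2 * Y) :=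
          div_le_div_of_nonneg_left (by positivity) hlog2Y hlogle
      _ ≤ _ := hSig
  -- the blocks tile `(X₁, 2^K X₁]`
  have hunion : ∀ K : ℕ,
      ∑ k ∈ range K, ∑ n ∈ (Ioc (2 ^ k * X₁) (2 ^ (k + 1) * X₁)).filter P, (1 : ℝ) / n =
        ∑ n ∈ (Ioc X₁ (2 ^ K * X₁)).filter P, (1 : ℝ) / n := by
    intro K
    induction K with
    | zero => simp
    | succ K ih =>
      rw [sum_range_succ, ih, ← sum_union (disjoint_filter_filter (Ioc_disjoint_Ioc_of_le le_rfl)),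
        ← filter_union, Ioc_union_Ioc_eq_Ioc]
      · exact Nat.le_mul_of_pos_left X₁ (Nat.two_pow_pos K)
      · exact Nat.mul_le_mul_right X₁ (Nat.pow_le_pow_right two_pos (Nat.le_succ K))
  -- harmonic divergence
  set B' : ℝ := B * (16 / (5 * c)) * Real.log (2 * X₁) with hB'
  obtain ⟨K, hK⟩ := (tendsto_atTop.mp Real.tendsto_sum_range_one_div_nat_succ_atTop B').exists
  refine ⟨(Ioc X₁ (2 ^ K * X₁)).filter P, fun n hn ↦ ?_, ?_⟩
  · rw [mem_filter, mem_Ioc] at hn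
    exact ⟨hn.2, by omega⟩
  · rw [← hunion K]
    calc B ≤ ∑ k ∈ range K, 5 * c / 16 / (((k : ℝ) + 1) * Real.log (2 * X₁)) := by
          have heq : ∑ k ∈ range K, 5 * c / 16 / (((k : ℝ) + 1) * Real.log (2 * X₁)) =
              (5 * c / 16 / Real.log (2 * X₁)) * ∑ k ∈ range K, 1 / ((k : ℝ) + 1) := by
            rw [mul_sum]
            refine sum_congr rfl fun k _ ↦ ?_
            have hk : (0 : ℝ) < (k : ℝ) + 1 := by positivity
            field_simp
          rw [heq]
          have h5 : 0 < 5 * c / 16 / Real.log (2 * X₁) := by positivity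
          calc B = (5 * c / 16 / Real.log (2 * X₁)) * B' := by
                rw [hB']; field_simp
            _ ≤ _ := mul_le_mul_of_nonneg_left hK h5.le
      _ ≤ _ := sum_le_sum fun k _ ↦ hblock k

/-- **`∑_{p ≡ 1 (N)} 1/p` diverges** (Dirichlet; Montgomery–Vaughan 2007, Cor. 4.12), in the finite
form used below: for all `B` and `P₀` there is a finite set `S` of primes `p ≡ 1 (mod N)`, `p > P₀`,
with `∑_{p ∈ S} 1/p ≥ B`. From the prime number theorem for the progression `1 mod N` in
`θ`-form (`Literature.NumberTheory.LFunctions.sum_log_prime_residue_isLittleO`, Montgomery–Vaughan Cor. 11.17, proved in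
`Literature.NumberTheory.LFunctions.PrimeNumberTheoremProgressions`) by
`exists_finset_le_sum_one_div_of_isLittleO`. [cite: MontgomeryVaughan2007, Cor. 4.12 with Cor. 11.17] -/
theorem exists_finset_prime_modEq_one_le_sum_one_div (N : ℕ) [NeZero N] (B : ℝ) (P₀ : ℕ) :
    ∃ S : Finset ℕ, (∀ p ∈ S, (p.Prime ∧ (p : ZMod N) = 1) ∧ P₀ < p) ∧
      B ≤ ∑ p ∈ S, (1 : ℝ) / p :=
  exists_finset_le_sum_one_div_of_isLittleO
    (inv_pos.mpr (by exact_mod_cast Nat.totient_pos.mpr (NeZero.pos N)))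
    (Literature.NumberTheory.LFunctions.sum_log_prime_residue_isLittleO (q := N) isUnit_one) B P₀

end Reciprocals

/-! ### Coefficients of a newform: multiplicativity at good primes and Hecke's bound -/

section Coefficients

variable {N : ℕ} [NeZero N] {k : ℤ}

/-- **Multiplicativity at a good prime**: for a newform `f ∈ S_k(Γ₀(N))`, a prime `p ∤ N` and
`p ∤ m`, `a_{pm}(f) = a_p(f) a_m(f)`: compare the `m`-th coefficients in `T_p f = a_p(f) f`
(`IsNewform0.heckeEigenvalue_eq_coeff_holds`) using
`a_m(T_p f) = a_{pm}(f) + 𝟙_{p ∤ N} p^{k-1} 𝟙_{p ∣ m} a_{m/p}(f)` (`qExpansion_coeff_heckeT_holds`,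
Diamond–Shurman Prop. 5.2.2(a), 5.3.1) (Atkin–Lehner 1970, Thm. 3; Diamond–Shurman Thm. 5.8.2).
This is the special case (no correction term) of `IsNewform0.cuspCoeff_prime_mul` of
`ModularityVersionAp` (all primes `p`, Diamond–Shurman Prop. 5.8.5), kept here with its short
proof so that the modular-symbol files do not import the elliptic-curve `L`-function closure of
that file; the librarian may replace it by that theorem. [cite: AtkinLehner1970, Thm. 3] -/
theorem IsNewform0.cuspCoeff_prime_mul_of_not_dvd {f : CuspForm (Gamma0 N) k} (hf : IsNewform0 f)
    {p : ℕ} (hp : p.Prime) (hpN : ¬ p ∣ N) {m : ℕ} (hpm : ¬ p ∣ m) :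
    cuspCoeff f (p * m) = cuspCoeff f p * cuspCoeff f m := by
  haveI : NeZero p := ⟨hp.ne_zero⟩
  have heig := heckeT_eq_heckeEigenvalue_smul f p (hf.2.1 p hp)
  have h1 := qExpansion_coeff_heckeT_holds N k f p hp m
  have hcoe : ⇑(heckeT (Gamma0 N) k p f) = heckeEigenvalue f p • ⇑f := by
    rw [heig]; rfl
  rw [hcoe, ModularForm.qExpansion_smul one_pos (one_mem_strictPeriods_gamma0 N) _ f, map_smul,
    smul_eq_mul, if_neg hpN, if_neg hpm, mul_zero, add_zero,
    IsNewform0.heckeEigenvalue_eq_coeff_holds hf hp] at h1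
  exact h1.symm

/-- **Multiplicativity over distinct good primes**: for a newform `f` and a finite set `S` of
primes not dividing `N`, `a_{∏_{p ∈ S} p}(f) = ∏_{p ∈ S} a_p(f)` (with `a_1(f) = 1`)
(Atkin–Lehner 1970, Thm. 3). [cite: AtkinLehner1970, Thm. 3] -/
theorem IsNewform0.cuspCoeff_prod_primes {f : CuspForm (Gamma0 N) k} (hf : IsNewform0 f)
    (S : Finset ℕ) (hS : ∀ p ∈ S, p.Prime ∧ ¬ p ∣ N) :
    cuspCoeff f (∏ p ∈ S, p) = ∏ p ∈ S, cuspCoeff f p := by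
  induction S using Finset.induction_on with
  | empty => rw [Finset.prod_empty, Finset.prod_empty]; exact hf.2.2
  | insert q S hq ih =>
    have hS' : ∀ p ∈ S, p.Prime ∧ ¬ p ∣ N := fun p hp ↦ hS p (Finset.mem_insert_of_mem hp)
    have hqP := hS q (Finset.mem_insert_self q S)
    rw [Finset.prod_insert hq, Finset.prod_insert hq, hf.cuspCoeff_prime_mul_of_not_dvd hqP.1 hqP.2,
      ih hS']
    intro hdvd
    obtain ⟨p, hp, hqp⟩ := (Prime.dvd_finsetProd_iff hqP.1.prime _).mp hdvd
    have := (Nat.prime_dvd_prime_iff_eq hqP.1 (hS' p hp).1).mp hqp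
    exact hq (this ▸ hp)

/-- **Hecke's bound**, packaged: for `f ∈ S₂(Γ₀(N))` there is `C > 0` with `|a_n(f)| ≤ C n` for
all `n` (Mathlib `CuspFormClass.qExpansion_isBigO`: `a_n = O(n^{k/2})`, here `k = 2`; and
`a_0 = 0`) (Hecke 1937; Diamond–Shurman Prop. 5.9.1). [cite: DiamondShurman2005, Prop. 5.9.1] -/
theorem exists_norm_cuspCoeff_le_mul (f : CuspForm (Gamma0 N) 2) :
    ∃ C : ℝ, 0 < C ∧ ∀ n : ℕ, ‖cuspCoeff f n‖ ≤ C * n := by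
  have h := CuspFormClass.qExpansion_isBigO f
  rw [strictWidthInfty_Gamma0] at h
  have h' : cuspCoeff f =O[atTop] fun n : ℕ ↦ (n : ℝ) :=
    (h.congr_left (f₂ := cuspCoeff f) fun n ↦ rfl).congr_right fun n ↦ by norm_num
  have h0 : ∀ n : ℕ, (fun n : ℕ ↦ (n : ℝ)) n = 0 → cuspCoeff f n = 0 := by
    intro n hn
    have : n = 0 := by simpa using hn
    subst this
    exact cuspCoeff_zero (one_mem_strictPeriods_gamma0 N) f
  obtain ⟨C, hC⟩ := (Asymptotics.isBigO_nat_atTop_iff h0).mp h'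
  refine ⟨max C 1, by positivity, fun n ↦ (hC n).trans ?_⟩
  rw [Real.norm_natCast]
  exact mul_le_mul_of_nonneg_right (le_max_left _ _) (Nat.cast_nonneg _)

/-- **Infinitely many primes `p ≡ 1 (mod N)` with `a_p(f) ≠ p + 1`** for a newform
`f ∈ S₂(Γ₀(N))` — the non-vanishing of Manin's factor `∑_{d ∣ m} d - c_m` (Manin 1972, Thm. 3.3,
(20): "`≠ 0` for large `m` by the growth estimates of the coefficients"), arranged prime by prime:
if `a_p = p + 1` for all primes `p ≡ 1 (mod N)` beyond `P₀`, then for a finite set `S` of such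
primes with `∑_{p ∈ S} 1/p ≥ C` (`exists_finset_prime_modEq_one_le_sum_one_div`, from the prime
number theorem for the progression) and `n = ∏_{p ∈ S} p`, multiplicativity gives
`a_n = ∏ (p + 1) ≥ n (1 + ∑ 1/p) > C n`, contradicting Hecke's bound `|a_n| ≤ C n`
(`exists_norm_cuspCoeff_le_mul`). [cite: Manin1972, Thm. 3.3 (20) and Thm. 3.5] -/
theorem IsNewform0.setOf_prime_cuspCoeff_ne_infinite {f : CuspForm (Gamma0 N) 2}
    (hf : IsNewform0 f) :
    {p : ℕ | p.Prime ∧ (p : ZMod N) = 1 ∧ cuspCoeff f p ≠ p + 1}.Infinite := by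
  intro hfin
  obtain ⟨P₀, hP₀⟩ := hfin.bddAbove
  have hgood : ∀ p : ℕ, p.Prime → (p : ZMod N) = 1 → P₀ < p → cuspCoeff f p = p + 1 := by
    intro p hp hp1 hlt
    by_contra hne
    exact absurd (hP₀ ⟨hp, hp1, hne⟩) (not_le.mpr hlt)
  obtain ⟨C, hC0, hC⟩ := exists_norm_cuspCoeff_le_mul f
  obtain ⟨S, hS, hB⟩ := exists_finset_prime_modEq_one_le_sum_one_div N C (max P₀ N)
  have hS' : ∀ p ∈ S, p.Prime ∧ ¬ p ∣ N := by
    intro p hp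
    obtain ⟨⟨hpr, -⟩, hlt⟩ := hS p hp
    refine ⟨hpr, fun h ↦ ?_⟩
    have := Nat.le_of_dvd (NeZero.pos N) h
    omega
  have hSval : ∀ p ∈ S, cuspCoeff f p = (p : ℂ) + 1 := by
    intro p hp
    obtain ⟨⟨hpr, hp1⟩, hlt⟩ := hS p hp
    exact hgood p hpr hp1 (lt_of_le_of_lt (le_max_left _ _) hlt)
  have han : cuspCoeff f (∏ p ∈ S, p) = ∏ p ∈ S, ((p : ℂ) + 1) := by
    rw [hf.cuspCoeff_prod_primes S hS']
    exact Finset.prod_congr rfl hSval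
  have hnorm : ‖cuspCoeff f (∏ p ∈ S, p)‖ = ∏ p ∈ S, ((p : ℝ) + 1) := by
    rw [han, norm_prod]
    refine Finset.prod_congr rfl fun p _ ↦ ?_
    have : ((p : ℂ) + 1) = ((p + 1 : ℕ) : ℂ) := by push_cast; ring
    rw [this, Complex.norm_natCast]
    push_cast
    ring
  have hle := hC (∏ p ∈ S, p)
  rw [hnorm, Nat.cast_prod] at hle
  have hpos : 0 < ∏ p ∈ S, (p : ℝ) :=
    Finset.prod_pos fun p hp ↦ by exact_mod_cast (hS' p hp).1.pos
  have hprod : ∏ p ∈ S, ((p : ℝ) + 1) = (∏ p ∈ S, (1 + 1 / (p : ℝ))) * ∏ p ∈ S, (p : ℝ) := by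
    rw [← Finset.prod_mul_distrib]
    refine Finset.prod_congr rfl fun p hp ↦ ?_
    have : (p : ℝ) ≠ 0 := by exact_mod_cast (hS' p hp).1.ne_zero
    field_simp
  rw [hprod] at hle
  have h1 : ∏ p ∈ S, (1 + 1 / (p : ℝ)) ≤ C := le_of_mul_le_mul_right hle hpos
  have h2 : 1 + ∑ p ∈ S, 1 / (p : ℝ) ≤ ∏ p ∈ S, (1 + 1 / (p : ℝ)) :=
    one_add_sum_le_prod_one_add S fun p _ ↦ by positivity
  linarith

end Coefficients

/-! ### Closing the path: `(a_p - p - 1) {∞, r}_f ∈ Λ_f` for `p ≡ 1 (mod N)` -/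

section Closing

variable {N : ℕ} [NeZero N] (f : CuspForm (Gamma0 N) 2)

/-- **Closing the path with `T_p`, `p ≡ 1 (mod N)`** (Manin 1972, Thm. 3.3, (20) and Thm. 3.5,
(22); Cremona 1997, (2.8.8), (2.9.1)): if the modular symbols of `f` satisfy the Hecke relation
`a {∞, r} = ∑_{j mod p} {∞, (r + j)/p} + {∞, p r}` for all `r` with some `a ∈ ℂ`, at a prime
`p ≡ 1 (mod N)`, then `(a - p - 1) {∞, r}_f ∈ Λ_f` for every `r`: each of the `p + 1` cusps on the
right is `Γ(N)`-equivalent to `r` (`Literature.NumberTheory.EllipticCurves.modularSymbol_mul_sub_mem_periodLattice`,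
`Literature.NumberTheory.EllipticCurves.modularSymbol_div_sub_mem_periodLattice`, Diamond–Shurman Lemma 3.8.2), so its symbol
differs from `{∞, r}` by a period. The case `a = p + 1 - n` is
`Literature.NumberTheory.EllipticCurves.nsmul_modularSymbol_mem_periodLattice_of_hecke`. [cite: Manin1972, Thm. 3.3 (20) and Thm. 3.5 (22)] -/
theorem sub_mul_modularSymbol_mem_periodLattice_of_hecke {p : ℕ} (hp : p.Prime)
    (hp1 : (p : ZMod N) = 1) {a : ℂ}
    (hH : ∀ r : ℚ, a * modularSymbol f r =
      ∑ j : Fin p, modularSymbol f ((r + j) / p) + modularSymbol f (p * r))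
    (r : ℚ) : (a - (p + 1)) * modularSymbol f r ∈ periodLattice f := by
  suffices key : ∀ (b c : ℤ), IsCoprime b c → c ≠ 0 →
      (a - (p + 1)) * modularSymbol f ((b : ℚ) / c) ∈ periodLattice f by
    have hcop : IsCoprime r.num (r.den : ℤ) := by
      rw [Int.isCoprime_iff_gcd_eq_one, Int.gcd, Int.natAbs_natCast]
      exact r.reduced
    have := key r.num r.den hcop (by exact_mod_cast r.den_ne_zero)
    have hr : ((r.num : ℤ) : ℚ) / ((r.den : ℤ) : ℚ) = r := by
      push_cast
      exact Rat.num_div_den r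
    rwa [hr] at this
  intro b c hbc hc0
  have h1 : modularSymbol f (p * ((b : ℚ) / c)) - modularSymbol f ((b : ℚ) / c) ∈
      periodLattice f := Literature.NumberTheory.EllipticCurves.modularSymbol_mul_sub_mem_periodLattice f hp hp1 hbc hc0
  have h2 : ∀ j : Fin p, modularSymbol f (((b : ℚ) / c + j) / p) - modularSymbol f ((b : ℚ) / c) ∈
      periodLattice f := by
    intro j
    have hcopj : IsCoprime (b + c * (j : ℕ)) c := hbc.add_mul_left_left _
    have hrj : ((b + c * (j : ℕ) : ℤ) : ℚ) / (c : ℚ) = (b : ℚ) / c + j := by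
      have hcQ : (c : ℚ) ≠ 0 := by exact_mod_cast hc0
      push_cast
      field_simp
    have := Literature.NumberTheory.EllipticCurves.modularSymbol_div_sub_mem_periodLattice f hp hp1 hcopj hc0
    rw [hrj] at this
    have htr : modularSymbol f ((b : ℚ) / c + j) = modularSymbol f ((b : ℚ) / c) := by
      have := modularSymbol_add_intCast_holds f ((b : ℚ) / c) ((j : ℕ) : ℤ)
      push_cast at this
      exact this
    rwa [htr] at this
  set x : ℚ := (b : ℚ) / c with hx
  have hmem : (∑ j : Fin p, (modularSymbol f ((x + j) / p) - modularSymbol f x)) +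
      (modularSymbol f (p * x) - modularSymbol f x) ∈ periodLattice f :=
    add_mem (sum_mem fun j _ ↦ h2 j) h1
  have heq : (∑ j : Fin p, (modularSymbol f ((x + j) / p) - modularSymbol f x)) +
      (modularSymbol f (p * x) - modularSymbol f x) = (a - (p + 1)) * modularSymbol f x := by
    rw [Finset.sum_sub_distrib, Finset.sum_const, Finset.card_univ, Fintype.card_fin,
      nsmul_eq_mul]
    linear_combination (-1 : ℂ) * hH x
  rwa [heq] at hmem

omit [NeZero N] in
/-- **Rational eigenvalues give rational combinations of periods** (Manin 1972, Thm. 3.5 and the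
remark before Cor. 3.6): if `(q - (p + 1)) z ∈ L` for a rational `q ≠ p + 1`, then `n z ∈ L` for
some integer `n > 0` (clear the denominator of `q`). [cite: Manin1972, Thm. 3.5] -/
theorem exists_nsmul_mem_of_ratCast_sub_mul_mem {L : AddSubgroup ℂ} {z : ℂ} {q : ℚ} {p : ℕ}
    (hq : q ≠ p + 1) (h : ((q : ℂ) - (p + 1)) * z ∈ L) : ∃ n : ℕ, 0 < n ∧ n • z ∈ L := by
  set m : ℤ := q.num - (p + 1) * q.den with hm
  have hm0 : m ≠ 0 := by
    intro h0
    apply hq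
    have h1 : (q.num : ℚ) = (p + 1) * q.den := by
      have : (q.num : ℤ) = (p + 1) * q.den := by linarith
      exact_mod_cast this
    have := Rat.num_div_den q
    rw [h1, mul_div_assoc, div_self (by exact_mod_cast q.den_ne_zero : (q.den : ℚ) ≠ 0),
      mul_one] at this
    exact this.symm
  have hmz : (m : ℂ) * z ∈ L := by
    have hden : (q.den : ℂ) * (((q : ℂ) - (p + 1)) * z) ∈ L := by
      rw [← nsmul_eq_mul]; exact L.nsmul_mem h _
    have hnum : (q.den : ℂ) * (q : ℂ) = q.num := by
      have := Rat.den_mul_eq_num q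
      exact_mod_cast congrArg (Rat.cast : ℚ → ℂ) this
    convert hden using 1
    rw [hm]; push_cast
    linear_combination -(z * hnum)
  refine ⟨m.natAbs, Int.natAbs_pos.mpr hm0, ?_⟩
  rw [nsmul_eq_mul, show ((m.natAbs : ℕ) : ℂ) = ((m.natAbs : ℤ) : ℂ) from (Int.cast_natCast _).symm]
  rcases Int.natAbs_eq m with h' | h'
  · rwa [← h']
  · have h'' : ((m.natAbs : ℕ) : ℤ) = -m := by omega
    rw [h'', Int.cast_neg, neg_mul]
    exact L.neg_mem hmz

end Closing

/-! ### Manin–Drinfeld for rational newforms and the rationality of `[r]^±` -/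

section ManinDrinfeld

variable {N : ℕ} [NeZero N] {f : CuspForm (Gamma0 N) 2}

/-- **Manin–Drinfeld for a rational newform, from one good prime in each tail** (Manin 1972,
Thm. 3.5, p. 35: "if the eigenvalues are rational, the cusp classes are *rational* combinations of
the fundamental periods"; Cor. 3.6): if `f ∈ S₂(Γ₀(N))` is a normalised newform with rational
coefficients and there are infinitely many primes `p ≡ 1 (mod N)` with `a_p(f) ≠ p + 1`, then every
`{∞, r}_f` has a positive multiple in `Λ_f`: for such a `p > N` the Hecke relation
`a_p {∞, r} = ∑_j {∞, (r + j)/p} + {∞, p r}` (`cuspCoeff_mul_modularSymbol`, Mazur–Tate–Teitelbaum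
(4.2)) closes up to `(a_p - p - 1) {∞, r} ∈ Λ_f` (`sub_mul_modularSymbol_mem_periodLattice_of_hecke`)
with `a_p ∈ ℚ`, `a_p ≠ p + 1`. [cite: Manin1972, Thm. 3.5 and Cor. 3.6] -/
theorem exists_nsmul_modularSymbol_mem_periodLattice_of_infinite (hf : IsNewform0 f)
    (hQ : coeffField f = ⊥)
    (hinf : {p : ℕ | p.Prime ∧ (p : ZMod N) = 1 ∧ cuspCoeff f p ≠ p + 1}.Infinite) :
    exists_nsmul_modularSymbol_mem_periodLattice f := by
  intro r
  obtain ⟨p, ⟨hp, hp1, hap⟩, hgt⟩ := hinf.exists_gt N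
  haveI : NeZero p := ⟨hp.ne_zero⟩
  have hpN : ¬ p ∣ N := fun h ↦ absurd (Nat.le_of_dvd (NeZero.pos N) h) (not_le.mpr hgt)
  have hmem : cuspCoeff f p ∈ coeffField f := coeff_mem_coeffField f p
  rw [hQ, IntermediateField.mem_bot] at hmem
  obtain ⟨q, hq⟩ := hmem
  have hq' : (q : ℂ) = cuspCoeff f p := by rw [← hq, eq_ratCast]
  have hH : ∀ s : ℚ, (q : ℂ) * modularSymbol f s =
      ∑ j : Fin p, modularSymbol f ((s + j) / p) + modularSymbol f (p * s) := fun s ↦ by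
    rw [hq']
    exact cuspCoeff_mul_modularSymbol (p := p) hf hp hpN s
  have hΛ := sub_mul_modularSymbol_mem_periodLattice_of_hecke f hp hp1 hH r
  have hne : q ≠ p + 1 := by
    intro h
    apply hap
    rw [← hq', h]
    push_cast
    ring
  exact exists_nsmul_mem_of_ratCast_sub_mul_mem hne hΛ

/-- **Manin–Drinfeld theorem for rational newforms** (Manin 1972, Thm. 3.5 and Cor. 3.6;
Drinfeld 1973; Cremona 1997, §2.8): for a normalised newform `f ∈ S₂(Γ₀(N))` with rational
coefficients, every modular symbol `{∞, r}_f` has a positive integer multiple in the period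
lattice `Λ_f` — the named fact `exists_nsmul_modularSymbol_mem_periodLattice f` of
`ModularSymbols`, **proved** for such `f`. The good primes are supplied by
`IsNewform0.setOf_prime_cuspCoeff_ne_infinite` (Hecke's bound and multiplicativity against
`∑_{p ≡ 1 (N)} 1/p = ∞`, the latter from the prime number theorem for the progression).
[cite: Manin1972, Thm. 3.5 and Cor. 3.6] -/
theorem exists_nsmul_modularSymbol_mem_periodLattice_of_isNewform0 (hf : IsNewform0 f)
    (hQ : coeffField f = ⊥) : exists_nsmul_modularSymbol_mem_periodLattice f :=
  exists_nsmul_modularSymbol_mem_periodLattice_of_infinite hf hQ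
    hf.setOf_prime_cuspCoeff_ne_infinite

omit [NeZero N] in
/-- If `n • z ∈ Λ_f` with `n > 0` and `im Λ_f = ℤ · (Ω/2)`, then `im z ∈ ℚ · Ω`. [folklore] -/
theorem exists_rat_im_eq_of_nsmul_mem {Ω : ℝ}
    (hΩ : imagPeriods f = AddSubgroup.zmultiples (Ω / 2)) {z : ℂ} {n : ℕ} (hn : 0 < n)
    (hz : n • z ∈ periodLattice f) : ∃ q : ℚ, z.im = q * Ω := by
  have him : (n • z).im ∈ imagPeriods f := AddSubgroup.mem_map_of_mem _ hz
  rw [hΩ, AddSubgroup.mem_zmultiples_iff] at him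
  obtain ⟨k, hk⟩ := him
  refine ⟨(k : ℚ) / (2 * n), ?_⟩
  have hn' : (n : ℝ) ≠ 0 := by exact_mod_cast hn.ne'
  rw [Complex.im_nsmul, nsmul_eq_mul, zsmul_eq_mul] at hk
  push_cast
  field_simp
  linarith

/-- **Manin–Drinfeld rationality of `[r]⁻` from the lattice facts** (the analogue of
`IsNewform0.exists_rat_smul_plusPeriod_of` for the minus symbol): `Ω⁻_f ≠ 0` and
`im (minusSymbol f r) ∈ ℚ · Ω⁻_f` follow from `isZLattice_periodLattice` (Eichler–Shimura),
`conj_mem_periodLattice` (together: `im Λ_f = ℤ · Ω⁻/2`, `Ω⁻ > 0`, `exists_pos_map_im_eq_zmultiples`)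
and `exists_nsmul_modularSymbol_mem_periodLattice f` (Manin–Drinfeld) (Manin 1972, Cor. 3.6;
Cremona 1997, §2.8; Mazur–Tate–Teitelbaum 1986, §I.8). [cite: Manin1972, Cor. 3.6] -/
theorem IsNewform0.exists_rat_smul_minusPeriod_of (H₁ : isZLattice_periodLattice (f := f))
    (H₂ : conj_mem_periodLattice (f := f))
    (H₃ : exists_nsmul_modularSymbol_mem_periodLattice f) :
    IsNewform0.exists_rat_smul_minusPeriod (f := f) := by
  intro hf hQ
  obtain ⟨_, hlat⟩ := H₁ hf hQ
  have h : ∃ Ω : ℝ, 0 < Ω ∧ imagPeriods f = AddSubgroup.zmultiples (Ω / 2) :=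
    exists_pos_map_im_eq_zmultiples hlat (fun _ hz ↦ H₂ hf hQ hz)
  have hΩ : minusPeriod f = h.choose := by simp only [minusPeriod, dif_pos h]
  have hpos : 0 < minusPeriod f := hΩ ▸ h.choose_spec.1
  have him : imagPeriods f = AddSubgroup.zmultiples (minusPeriod f / 2) := hΩ ▸ h.choose_spec.2
  refine ⟨hpos.ne', fun r ↦ ?_⟩
  obtain ⟨n, hn, hnr⟩ := H₃ r
  obtain ⟨n', hn', hnr'⟩ := H₃ (-r)
  obtain ⟨q, hq⟩ := exists_rat_im_eq_of_nsmul_mem him hn hnr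
  obtain ⟨q', hq'⟩ := exists_rat_im_eq_of_nsmul_mem him hn' hnr'
  refine ⟨(q - q') / 2, ?_⟩
  rw [minusSymbol, Complex.div_ofNat_im, Complex.sub_im, hq, hq', Rat.smul_def]
  push_cast
  ring

/-- **`IsNewform0.exists_rat_smul_plusPeriod` from Eichler–Shimura alone**: for a normalised
newform `f ∈ S₂(Γ₀(N))` with rational coefficients, *if* `Λ_f` is a lattice
(`isZLattice_periodLattice`, Shimura 1971, Thm. 7.14), then `Ω⁺_f ≠ 0` and
`re [r]⁺ ∈ ℚ · Ω⁺_f` for all `r ∈ ℚ`. The other two inputs of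
`IsNewform0.exists_rat_smul_plusPeriod_of` are now theorems: conjugation-stability
(`conj_mem_periodLattice_holds`) and Manin–Drinfeld
(`exists_nsmul_modularSymbol_mem_periodLattice_of_isNewform0`).
[cite: Manin1972, Cor. 3.6 with Thm. 1.9] -/
theorem IsNewform0.exists_rat_smul_plusPeriod_of_isZLattice
    (H : isZLattice_periodLattice (f := f)) :
    IsNewform0.exists_rat_smul_plusPeriod (f := f) := fun hf hQ ↦
  IsNewform0.exists_rat_smul_plusPeriod_of H conj_mem_periodLattice_holds
    (exists_nsmul_modularSymbol_mem_periodLattice_of_isNewform0 hf hQ) hf hQ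

/-- **`IsNewform0.exists_rat_smul_minusPeriod` from Eichler–Shimura alone.**
[cite: Manin1972, Cor. 3.6] -/
theorem IsNewform0.exists_rat_smul_minusPeriod_of_isZLattice
    (H : isZLattice_periodLattice (f := f)) :
    IsNewform0.exists_rat_smul_minusPeriod (f := f) := fun hf hQ ↦
  IsNewform0.exists_rat_smul_minusPeriod_of H conj_mem_periodLattice_holds
    (exists_nsmul_modularSymbol_mem_periodLattice_of_isNewform0 hf hQ) hf hQ

/-- **`IsNewform0.exists_rat_smul_plusPeriod` from the rank statement of Eichler–Shimura**
(`periodLattice_eq_closure_pair`: `Λ_f = ℤω₁ + ℤω₂`, Cremona 1997, (2.10.1)–(2.10.2); the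
spanning half of the lattice property is the theorem `periodLattice_span_eq_top`).
[cite: Manin1972, Cor. 3.6 with Thm. 1.9] -/
theorem IsNewform0.exists_rat_smul_plusPeriod_of_closure_pair
    (H : periodLattice_eq_closure_pair (f := f)) :
    IsNewform0.exists_rat_smul_plusPeriod (f := f) :=
  IsNewform0.exists_rat_smul_plusPeriod_of_isZLattice (isZLattice_periodLattice_of H)

/-- **`IsNewform0.exists_rat_smul_minusPeriod` from the rank statement of Eichler–Shimura.**
[cite: Manin1972, Cor. 3.6] -/
theorem IsNewform0.exists_rat_smul_minusPeriod_of_closure_pair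
    (H : periodLattice_eq_closure_pair (f := f)) :
    IsNewform0.exists_rat_smul_minusPeriod (f := f) :=
  IsNewform0.exists_rat_smul_minusPeriod_of_isZLattice (isZLattice_periodLattice_of H)

/-- `[r]⁺_f ∈ ℚ` (`IsNewform0.exists_normalizedPlusSymbol_eq_ratCast`, Mazur–Tate–Teitelbaum §I.8)
from the rank statement of Eichler–Shimura alone. [cite: MazurTateTeitelbaum1986Invent, §I.8] -/
theorem IsNewform0.exists_normalizedPlusSymbol_eq_ratCast_of_closure_pair
    (H : periodLattice_eq_closure_pair (f := f)) :
    IsNewform0.exists_normalizedPlusSymbol_eq_ratCast (f := f) :=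
  IsNewform0.exists_normalizedPlusSymbol_eq_ratCast_of
    (IsNewform0.exists_rat_smul_plusPeriod_of_closure_pair H)

/-- **`IsNewform0.exists_rat_smul_plusPeriod` from the Eichler–Shimura lattice statement for the
period homology alone**: `periodHomology_eq_span_basis N` (the period homology
`{h ↦ ⟨γ, h⟩ : γ ∈ Γ₀(N)} ⊆ S₂(Γ₀(N))^∨` is the `ℤ`-span of an `ℝ`-basis, Diamond–Shurman §6.1 /
Cremona (2.10.1)) gives `periodLattice_eq_closure_pair` for every rational newform
(`periodLattice_eq_closure_pair_of`, `ModularSymbolsPeriodHomology`, using multiplicity one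
`IsNewform0.mem_span_of_forall_heckeT_eq_smul`), whence the target by
`IsNewform0.exists_rat_smul_plusPeriod_of_closure_pair`. [cite: Manin1972, Cor. 3.6 with Thm. 1.9] -/
theorem IsNewform0.exists_rat_smul_plusPeriod_of_periodHomology
    (hES : periodHomology_eq_span_basis N) :
    IsNewform0.exists_rat_smul_plusPeriod (f := f) :=
  IsNewform0.exists_rat_smul_plusPeriod_of_closure_pair (periodLattice_eq_closure_pair_of hES)

/-- **`IsNewform0.exists_rat_smul_minusPeriod` from `periodHomology_eq_span_basis` alone.**
[cite: Manin1972, Cor. 3.6] -/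
theorem IsNewform0.exists_rat_smul_minusPeriod_of_periodHomology
    (hES : periodHomology_eq_span_basis N) :
    IsNewform0.exists_rat_smul_minusPeriod (f := f) :=
  IsNewform0.exists_rat_smul_minusPeriod_of_closure_pair (periodLattice_eq_closure_pair_of hES)

/-- `[r]⁺_f ∈ ℚ` from `periodHomology_eq_span_basis` alone. [cite: MazurTateTeitelbaum1986Invent, §I.8] -/
theorem IsNewform0.exists_normalizedPlusSymbol_eq_ratCast_of_periodHomology
    (hES : periodHomology_eq_span_basis N) :
    IsNewform0.exists_normalizedPlusSymbol_eq_ratCast (f := f) :=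
  IsNewform0.exists_normalizedPlusSymbol_eq_ratCast_of
    (IsNewform0.exists_rat_smul_plusPeriod_of_periodHomology hES)

end ManinDrinfeld

end Literature.NumberTheory.EllipticCurves.ModularForms
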